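import Summits.Ventures.DiscreteObjects.Hadamard.SignedMultiplierTMatrices668Census
import Summits.Ventures.DiscreteObjects.Hadamard.PAFParityTools

/-!
# Hadamard 668 census — signed and permuted multipliers of circulant T-matrices of order 167, III: none exist

Framing: lottery ticket; floor = certified bounds/negative ranges.

Cell pub-namedobj (venture DiscreteObjects), target (H), hadamard gen 25 (HANDOFF-H-g24 item 5b), concluding
`SignedMultiplierTMatrices668` (I: a signed/permuted multiplier `t_{π k}(h x) = ε_k t_k(x)` of first rows of circulant
T-matrices of order `167` has `h = -1`) and `…Census` (II: for `h = -1`, `π` is a transposition of two rows vanishing at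
`0`, the row through `0` and the fourth row are symmetric/skew, and the fourth row sum is `±10, ±6, ±2`).
A PARITY ARGUMENT finishes the census (the group ring `𝔽₂[C_n]`: for a symmetric or skew row `T* = ±T`, so
`T T* = ±T²`, and squaring is injective on exponents for odd `n`):
* `paf_castTwo_of_neg_rel` — for `n` odd and a row with `t(-x) = ε t(x)` (`ε = ±1`), `PAF_t(2c) ≡ t(c)² (mod 2)` (the terms
  `t(x) t(x + 2c)` pair off under `x ↦ -x - 2c`, whose only fixed point is `x = -c`);
* **`no_signedSymmetric_tMatrixRows_odd`** — hence NO circulant T-matrices of ANY odd order `n > 1` have all four first rows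
  symmetric or skew (`Σ_k PAF_k(2c) = 0` but `Σ_k t_k(c)² = 1` for `c ≠ 0`); this supersedes gen 24's
  `no_symmetric_tMatrixRows` (`n ≡ 3 (mod 4)`, all signs `+`) and part II's `no_signedSymmetric_tMatrixRows_167`;
* **`no_signedMultiplier_negOne_167`** — in the residual transposition shape of part II the reversal pair contributes
  `2·PAF ≡ 0 (mod 2)`, so `t_{k₀}(c)² + t_{k₃}(c)² ≡ 0` for `c ≠ 0`: the fourth row VANISHES identically, contradicting its
  row sum `±10, ±6, ±2` — the residual shape is EMPTY;
* **`no_signedMultiplier_tMatrixRows_167`** — with part I: **circulant T-matrices of order 167 admit no signed/permuted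
  multiplier whatsoever** (`h ≠ 0, 1`; any `π ∈ S₄`, any signs) — the complete multiplier census of the T-matrix route
  to `H(668)`;
* `no_reversal_tSeq_167` — the aperiodic corollary: T-SEQUENCES of length `167` admit no reversal symmetry
  `t_{π k}(166 - i) = ε_k t_k(i)` (any `π`, any signs; periodise and translate by the midpoint `83`);
* `signedMultiplier_tMatrixRows_167_final` — summary conjunction (citation point).
NEGATIVE lines about a hypothetical object (the structured sub-families are empty; unstructured T-matrices / T-sequences
of order 167 remain OPEN); no Hadamard order excluded; H(668) untouched; HITS 0/4.  Ours, elementary; no `sorry`.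
-/

open Finset BigOperators

namespace Summit.Ventures.DiscreteObjects.Hadamard

open Literature.Combinatorics.Designs.LegendrePairs (PAF)
open Literature.Combinatorics.Designs.TSequences
open Literature.Combinatorics.Designs.TMatrices

/-! ## §9 Parity of periodic autocorrelations of symmetric / skew rows -/

section Parity

variable {n : ℕ} [NeZero n]

/-- the signed reversal `u(-x) = ε t(x)` of a row has the same periodic autocorrelation. -/
lemma paf_of_signed_reversal {t u : ZMod n → ℤ} {ε : ℤ} (hε : ε = 1 ∨ ε = -1) (hu : ∀ x, u (-x) = ε * t x)
    (s : ZMod n) : PAF u s = PAF t s := by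
  have hu' : ∀ x, u x = ε * t (-x) := fun x => by rw [← hu (-x), neg_neg]
  have hε2 : ε * ε = 1 := by rcases hε with e | e <;> simp [e]
  rw [← PAF_neg t s]
  unfold PAF
  calc ∑ x, u x * u (x + s) = ∑ x, t (-x) * t (-x + -s) := Finset.sum_congr rfl fun x _ => by
        rw [hu' x, hu' (x + s), neg_add]
        calc ε * t (-x) * (ε * t (-x + -s)) = ε * ε * (t (-x) * t (-x + -s)) := by ring
          _ = t (-x) * t (-x + -s) := by rw [hε2, one_mul]
    _ = ∑ y, t y * t (y + -s) := Fintype.sum_equiv (Equiv.neg (ZMod n)) _ _ fun x => by simp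

/-- **parity of the autocorrelation of a symmetric or skew row** (`n` odd): if `t(-x) = ε t(x)` with `ε = ±1` then
`PAF_t(2c) ≡ t(c)² (mod 2)` — the terms `t(x) t(x + 2c)` pair off under `x ↦ -x - 2c`, except the fixed term `x = -c`
(in the group ring `𝔽₂[C_n]`: `T T* = ±T²` and `T(x)² = T(x²)`). -/
theorem paf_castTwo_of_neg_rel (hn : n % 2 = 1) (t : ZMod n → ℤ) {ε : ℤ} (hε : ε = 1 ∨ ε = -1)
    (ht : ∀ x, t (-x) = ε * t x) (c : ZMod n) :
    ((PAF t (c + c) : ℤ) : ZMod 2) = ((t c ^ 2 : ℤ) : ZMod 2) := by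
  have hε2 : ε * ε = 1 := by rcases hε with e | e <;> simp [e]
  -- recentre at the fixed point `-c`
  set g : ZMod n → ℤ := fun y => t (y - c) * t (y + c) with hg
  have hsum : PAF t (c + c) = ∑ y, g y := by
    unfold PAF
    exact Fintype.sum_equiv (Equiv.addRight c) _ _ fun x => by
      simp only [hg, Equiv.coe_addRight, add_sub_cancel_right]
      rw [add_assoc]
  have hsymm : ∀ y, g (-y) = g y := fun y => by
    simp only [hg]
    rw [show -y - c = -(y + c) by ring, show -y + c = -(y - c) by ring, ht, ht]
    calc ε * t (y + c) * (ε * t (y - c)) = ε * ε * (t (y - c) * t (y + c)) := by ring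
      _ = t (y - c) * t (y + c) := by rw [hε2, one_mul]
  rw [hsum, sum_symm_castTwo hn g hsymm]
  simp only [hg, zero_sub, zero_add, ht]
  have hεc : ((ε : ℤ) : ZMod 2) = 1 := by
    rcases hε with e | e <;> rw [e] <;> decide
  push_cast
  rw [hεc, one_mul, sq]

/-- in `ZMod n` with `n` odd, `c + c = 0` forces `c = 0`. -/
lemma add_self_eq_zero_odd (hn : n % 2 = 1) {c : ZMod n} (h : c + c = 0) : c = 0 := by
  have h2 : -c = c := by
    have : c = -c := eq_neg_of_add_eq_zero_left h
    exact this.symm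
  exact eq_zero_of_neg_eq_self hn h2

/-- **no symmetric/skew circulant T-matrices of odd order `n > 1`** (any pattern of signs): if every first row satisfies
`t_k(-x) = ε_k t_k(x)`, then for `c ≠ 0` the identity `Σ_k PAF_k(2c) = 0` reads `Σ_k t_k(c)² ≡ 0 (mod 2)`, while exactly
one `t_k(c)` is `±1`.  (Supersedes `no_symmetric_tMatrixRows`, which needed `n ≡ 3 (mod 4)` and all signs `+`.) -/
theorem no_signedSymmetric_tMatrixRows_odd (hn : n % 2 = 1) (h1 : 1 < n) {t : Fin 4 → ZMod n → ℤ}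
    (ht : IsTMatrixRows n t) {ε : Fin 4 → ℤ} (hε : ∀ k, ε k = 1 ∨ ε k = -1)
    (hsym : ∀ k x, t k (-x) = ε k * t k x) : False := by
  -- a non-zero residue
  have hc : (1 : ZMod n) ≠ 0 := by
    intro h
    have := (ZMod.natCast_eq_zero_iff 1 n).mp (by exact_mod_cast h)  -- n ∣ 1
    exact absurd (Nat.le_of_dvd one_pos this) (by omega)
  set c : ZMod n := 1
  have hs : c + c ≠ 0 := fun h => hc (add_self_eq_zero_odd hn h)
  have hsum := ht.2 (c + c) hs
  have hcast := congrArg (Int.cast : ℤ → ZMod 2) hsum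
  push_cast at hcast
  rw [Finset.sum_congr rfl fun k _ => paf_castTwo_of_neg_rel hn (t k) (hε k) (hsym k) c] at hcast
  -- but Σ_k t_k(c)² = 1
  have hone := tmatrixRows_sum_sq_entry ht c
  have hone' : ((∑ k, t k c ^ 2 : ℤ) : ZMod 2) = 1 := by
    rw [show ∑ k, t k c ^ 2 = ∑ k, t k c * t k c from Finset.sum_congr rfl fun k _ => sq _, hone, Int.cast_one]
  push_cast at hcast hone'
  rw [hcast] at hone'
  exact zero_ne_one hone'

end Parity

/-! ## §10 The residual transposition shape is empty at 167 -/

/-- **no signed/permuted multiplier `-1` for circulant T-matrices of order 167.**  In the residual shape of part II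
(`π = (k₁ k₂)`, rows `k₀, k₃` symmetric or skew, `t_{k₂}` the signed reversal of `t_{k₁}` so `PAF_{k₂} = PAF_{k₁}`),
reducing `Σ_k PAF_k(2c) = 0` mod `2` gives `t_{k₀}(c)² + t_{k₃}(c)² ≡ 0`, hence `t_{k₃}(c) = 0` for every `c ≠ 0`; with
`t_{k₃}(0) = 0` the fourth row vanishes, contradicting its row sum `±10, ±6, ±2` from the census. -/
theorem no_signedMultiplier_negOne_167 :
    ¬ ∃ (t : Fin 4 → ZMod 167 → ℤ) (π : Equiv.Perm (Fin 4)) (ε : Fin 4 → ℤ),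
      IsTMatrixRows 167 t ∧ (∀ k, ε k = 1 ∨ ε k = -1) ∧ ∀ k x, t (π k) (-x) = ε k * t k x := by
  rintro ⟨t, π, ε, ht, hε, hmul⟩
  obtain ⟨k₀, k₁, k₂, k₃, h10, h20, h30, h12, h13, h23, hk₀, hπ₀, -, c1, -, c3, -, htab⟩ :=
    signedMultiplier_negOne_167_census ht hε hmul
  have r0 : ∀ x, t k₀ (-x) = ε k₀ * t k₀ x := fun x => by rw [← hmul k₀ x, hπ₀]
  have r3 : ∀ x, t k₃ (-x) = ε k₃ * t k₃ x := fun x => by rw [← hmul k₃ x, c3]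
  have r12 : ∀ x, t k₂ (-x) = ε k₁ * t k₁ x := fun x => by rw [← hmul k₁ x, c1]
  have hP12 : ∀ s, PAF (t k₂) s = PAF (t k₁) s := paf_of_signed_reversal (hε k₁) r12
  -- the fourth row vanishes off `0`
  have key : ∀ c : ZMod 167, c ≠ 0 → t k₃ c = 0 := by
    intro c hc
    have hs : c + c ≠ 0 := fun h => hc (add_self_eq_zero_odd (n := 167) (by norm_num) h)
    have hsum := ht.2 (c + c) hs
    rw [sum_fin4_of_distinct _ (Ne.symm h10) (Ne.symm h20) (Ne.symm h30) h12 h13 h23, hP12] at hsum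
    have hcast := congrArg (Int.cast : ℤ → ZMod 2) hsum
    push_cast at hcast
    rw [paf_castTwo_of_neg_rel (n := 167) (by norm_num) (t k₀) (hε k₀) r0 c,
      paf_castTwo_of_neg_rel (n := 167) (by norm_num) (t k₃) (hε k₃) r3 c] at hcast
    -- `P + P = 0` in `ZMod 2`
    have h2 : ∀ z : ZMod 2, z + z = 0 := by decide
    push_cast at hcast
    have hpar : ((t k₀ c ^ 2 + t k₃ c ^ 2 : ℤ) : ZMod 2) = 0 := by
      push_cast
      have e : ((t k₀ c : ℤ) : ZMod 2) ^ 2 + (PAF (t k₁) (c + c) : ZMod 2) + (PAF (t k₁) (c + c) : ZMod 2) +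
          ((t k₃ c : ℤ) : ZMod 2) ^ 2 = ((t k₀ c : ℤ) : ZMod 2) ^ 2 + ((t k₃ c : ℤ) : ZMod 2) ^ 2 +
          ((PAF (t k₁) (c + c) : ZMod 2) + (PAF (t k₁) (c + c) : ZMod 2)) := by ring
      rw [e, h2, add_zero] at hcast
      exact hcast
    -- the entries at `c`: exactly one of the four is `±1`
    obtain ⟨k, hk, hz⟩ := ht.1 c
    by_contra h3
    have hk3 : k = k₃ := by_contra fun hne => h3 (hz k₃ (Ne.symm hne))
    subst hk3
    have h00 : t k₀ c = 0 := hz k₀ (Ne.symm h30)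
    rw [h00] at hpar
    rcases hk with e | e <;> rw [e] at hpar <;> exact absurd hpar (by decide)
  -- and at `0`
  obtain ⟨k', -, hz0⟩ := ht.1 0
  have hk' : k₀ = k' := by
    by_contra hne
    exact hk₀ (hz0 k₀ hne)
  have h30' : t k₃ 0 = 0 := hz0 k₃ (by rw [← hk']; exact h30)
  have hzero : ∀ c, t k₃ c = 0 := fun c => by
    by_cases hc : c = 0
    · rw [hc]; exact h30'
    · exact key c hc
  have hS : (∑ x, t k₃ x) = 0 := Finset.sum_eq_zero fun x _ => hzero x
  rw [hS, Int.natAbs_zero] at htab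
  omega

/-! ## §11 The complete census: no signed/permuted multiplier at all -/

/-- **Circulant T-matrices of order 167 admit no signed/permuted multiplier.**  For every `h ∈ ZMod 167`, `h ≠ 0, 1`,
every permutation `π` of the four rows and every choice of signs `ε_k = ±1`, no first rows of circulant T-matrices of
order `167` satisfy `t_{π k}(h x) = ε_k t_k(x)` (part I: `h = -1`; §10: `-1` is impossible too). -/
theorem no_signedMultiplier_tMatrixRows_167 {h : ZMod 167} (h0 : h ≠ 0) (h1 : h ≠ 1) :
    ¬ ∃ (t : Fin 4 → ZMod 167 → ℤ) (π : Equiv.Perm (Fin 4)) (ε : Fin 4 → ℤ),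
      IsTMatrixRows 167 t ∧ (∀ k, ε k = 1 ∨ ε k = -1) ∧ ∀ k x, t (π k) (h * x) = ε k * t k x := by
  rintro ⟨t, π, ε, ht, hε, hmul⟩
  have hneg := signedMultiplier_167_eq_neg_one ht h0 h1 hε hmul
  subst hneg
  exact no_signedMultiplier_negOne_167 ⟨t, π, ε, ht, hε, fun k x => by rw [← hmul k x, neg_one_mul]⟩

/-! ## §12 Aperiodic corollary: T-sequences of length 167 have no reversal symmetry -/

section Reversal

variable {n : ℕ}

/-- translating first rows of circulant T-matrices (`x ↦ x + c`) gives first rows of circulant T-matrices. -/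
lemma tmatrixRows_translate [NeZero n] {t : Fin 4 → ZMod n → ℤ} (ht : IsTMatrixRows n t) (c : ZMod n) :
    IsTMatrixRows n (fun k x => t k (x + c)) := by
  refine ⟨fun x => ht.1 (x + c), fun s hs => ?_⟩
  have h := ht.2 s hs
  have hP : ∀ k, PAF (fun x => t k (x + c)) s = PAF (t k) s := fun k =>
    Literature.Combinatorics.Designs.LegendrePairs.PAF_translate (t k) c s
  simpa only [hP] using h

end Reversal

/-- reading a reversal relation periodically: for `x : ZMod 167`, `(-x + 83).val = 166 - (x + 83).val` (the reflection
`i ↦ 166 - i` of `{0, …, 166}` is `x ↦ -x` after translating by the midpoint `83`). -/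
lemma val_neg_add_83 (x : ZMod 167) : (-x + 83).val = 166 - (x + 83).val := by
  have hi : (x + 83).val < 167 := ZMod.val_lt _
  have hcast : (-x + 83 : ZMod 167) = ((166 - (x + 83).val : ℕ) : ZMod 167) := by
    rw [Nat.cast_sub (by omega), ZMod.natCast_zmod_val]
    push_cast
    ring
  rw [hcast, ZMod.val_natCast, Nat.mod_eq_of_lt (by omega)]

/-- **T-sequences of length 167 admit no reversal symmetry**: no T-sequences `t` of length `167`, permutation `π` of the
four sequences and signs `ε_k = ±1` satisfy `t_{π k}(166 - i) = ε_k t_k(i)` for all `i < 167` (periodise and translate by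
`83`: the reflection becomes the multiplier `-1`, excluded by `no_signedMultiplier_negOne_167`).  In particular no
T-sequences of length 167 consist of reversal-symmetric or reversal-skew sequences, and none is mapped to itself, up to
reordering and signs, by reversal. -/
theorem no_reversal_tSeq_167 :
    ¬ ∃ (t : Fin 4 → ℕ → ℤ) (π : Equiv.Perm (Fin 4)) (ε : Fin 4 → ℤ), IsTSeq 167 t ∧ (∀ k, ε k = 1 ∨ ε k = -1) ∧
      ∀ k, ∀ i < 167, t (π k) (166 - i) = ε k * t k i := by
  rintro ⟨t, π, ε, ht, hε, hrev⟩
  set u : Fin 4 → ZMod 167 → ℤ := fun k x => periodize 167 (t k) (x + 83) with hu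
  have hut : IsTMatrixRows 167 u := tmatrixRows_translate (tseq_tmatrixRows ht) 83
  have hmul : ∀ k x, u (π k) (-x) = ε k * u k x := fun k x => by
    simp only [hu, periodize]
    show t (π k) (-x + 83).val = ε k * t k (x + 83).val
    rw [val_neg_add_83]
    exact hrev k _ (ZMod.val_lt _)
  exact no_signedMultiplier_negOne_167 ⟨u, π, ε, hut, hε, hmul⟩

/-! ## §13 Summary -/

/-- **Signed/permuted multipliers of circulant T-matrices of order 167 — final summary (citation point).**
(i) for `h ≠ 0, 1` in `ZMod 167`, `π ∈ S₄`, `ε ∈ {±1}⁴`: no first rows of circulant T-matrices of order `167` with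
`t_{π k}(h x) = ε_k t_k(x)`; (ii) in particular none with `t_{π k}(-x) = ε_k t_k(x)`; (iii) no T-sequences of length `167`
with a reversal symmetry `t_{π k}(166 - i) = ε_k t_k(i)`; (iv) for every odd `n > 1`: no circulant T-matrices of order `n`
with all four first rows symmetric or skew.  The structured (multiplier / reversal) sub-families of the T-matrix and
T-sequence routes to `H(668)` are EMPTY; unstructured ones remain open; no Hadamard order is excluded.
lottery ticket; floor = certified bounds/negative ranges. -/
theorem signedMultiplier_tMatrixRows_167_final :
    (∀ h : ZMod 167, h ≠ 0 → h ≠ 1 →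
      ¬ ∃ (t : Fin 4 → ZMod 167 → ℤ) (π : Equiv.Perm (Fin 4)) (ε : Fin 4 → ℤ),
        IsTMatrixRows 167 t ∧ (∀ k, ε k = 1 ∨ ε k = -1) ∧ ∀ k x, t (π k) (h * x) = ε k * t k x) ∧
    (¬ ∃ (t : Fin 4 → ZMod 167 → ℤ) (π : Equiv.Perm (Fin 4)) (ε : Fin 4 → ℤ),
      IsTMatrixRows 167 t ∧ (∀ k, ε k = 1 ∨ ε k = -1) ∧ ∀ k x, t (π k) (-x) = ε k * t k x) ∧
    (¬ ∃ (t : Fin 4 → ℕ → ℤ) (π : Equiv.Perm (Fin 4)) (ε : Fin 4 → ℤ), IsTSeq 167 t ∧ (∀ k, ε k = 1 ∨ ε k = -1) ∧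
      ∀ k, ∀ i < 167, t (π k) (166 - i) = ε k * t k i) ∧
    (∀ (n : ℕ) [NeZero n], n % 2 = 1 → 1 < n → ∀ (t : Fin 4 → ZMod n → ℤ) (ε : Fin 4 → ℤ), IsTMatrixRows n t →
      (∀ k, ε k = 1 ∨ ε k = -1) → (∀ k x, t k (-x) = ε k * t k x) → False) :=
  ⟨fun _ h0 h1 => no_signedMultiplier_tMatrixRows_167 h0 h1, no_signedMultiplier_negOne_167, no_reversal_tSeq_167,
    fun _ _ hn h1 _ _ ht hε hsym => no_signedSymmetric_tMatrixRows_odd hn h1 ht hε hsym⟩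

end Summit.Ventures.DiscreteObjects.Hadamard
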